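import Mathlib
import Literature.NumberTheory.LFunctions.Zhang2022.TypedSection15ASubsteps
import Literature.NumberTheory.LFunctions.Zhang2022.Section15I2plusTheta2
import HarnessLib

/-!
# Zhang (2022) §15 part A sub-steps — the kernel-checked EDGES and exact halves (theorems only)

Topic `Literature/NumberTheory/LFunctions/Zhang2022` (Landau–Siegel audit tree; verdict-neutral).
Y. Zhang, *Discrete mean estimates and the Landau–Siegel zero*, arXiv:2211.02515v1 (2022)
[Zhang2022LandauSiegel] — an unrefereed manuscript under adjudication; nothing here asserts or denies
its Theorems 1–2. Companion of `TypedSection15ASubsteps` (lane ZHANG-L, WP15): for the helper claims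
typed there, the parts that are IDENTITIES of the tree's objects are proved and the bookkeeping edges
to the typed nodes of `Typed.Section15A` are kernel-checked:
* `eq15_5b_chi_holds` — `Eq15_5b c′ bChi` is the tree's identity `sum_I2pm_one_eq_Theta2`
  (`Section15I2plusTheta2`, landed while this file was drafted: on `𝔍(1)` the integrand `𝔨₁(s,ψ)ω(s)`
  IS the `Θ₂(0,κ₁∗(χb),g̃₃)`-integrand), hence `eq15_5_chi_of_move : Eq15_5a c′ → Eq15_5 c′ bChi` —
  (15.5) at the reading of record reduces to the (Ψ₁-summed) segment move alone (the per-character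
  form of the same edge is the tree's `eq15_5_chi_of_shift`);
* `ktildeSeries_eq_twist` — the exact step `ψ̄(D)D^{s−1}Σ_m k̃(m)ψ̄(m)m^{s−1} = Σ_m k̃(m)ψ̄(Dm)(Dm)^{s−1}`
  inside u008;
* `step15_u009_of_parts : Step15_u009a → Step15_u009b → Step15_u009`;
* `step15_u011w_holds` — u011 on the consumer's range (`n, Dm < p`), `C = 1`.
No new claims. [cite: Zhang2022LandauSiegel, §15 pp. 80–81]
-/

noncomputable section

open Complex Real ComplexConjugate

namespace Literature.NumberTheory.LFunctions.Zhang2022.Typed.Section15A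

open Literature.NumberTheory.LFunctions.Zhang2022.Skeleton

/-! ## (15.5) -/

/-- **(15.5) from its two halves** (triangle-free: the second half is an identity).
[cite: Zhang2022LandauSiegel, §15 (15.5) p. 81] -/
theorem eq15_5_of_parts (c' : ℝ) (b : CoefFam) (ha : Eq15_5a c') (hb : Eq15_5b c' b) :
    Eq15_5 c' b := by
  obtain ⟨c, hc, C, D₀, hF⟩ := ha
  refine ⟨c, hc, C, D₀, fun D _ χ hD hq hp hA => ?_⟩
  rw [← hb D χ]
  exact hF D χ hD hq hp hA

section FifteenFiveB

variable (c' : ℝ)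

/-- **`Eq15_5b` holds at the χ-reading `bChi`** — the tree's `sum_I2pm_one_eq_Theta2`
(`Section15I2plusTheta2`): `Σ_{ψ∈Ψ₁}(1/2πi)∫_{𝔍(1)}𝔨₁(s,ψ)ω(s)ds = Θ₂(0,κ₁∗(χb),g̃₃)`, every `D`, `χ`.
[cite: Zhang2022LandauSiegel, §15 (15.5) p. 81] -/
theorem eq15_5b_chi_holds : Eq15_5b c' bChi := fun _ _ χ => sum_I2pm_one_eq_Theta2 c' χ

/-- **(15.5) at the χ-reading from the segment move alone**: `Eq15_5a c′ → Eq15_5 c′ bChi`.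
[cite: Zhang2022LandauSiegel, §15 (15.5) p. 81] -/
theorem eq15_5_chi_of_move (h : Eq15_5a c') : Eq15_5 c' bChi :=
  eq15_5_of_parts c' bChi h (eq15_5b_chi_holds c')

end FifteenFiveB

/-! ## u008: the exact twist step -/

section KTildeTwist

variable (c' : ℝ) {D : ℕ} (x : Chr D)

/-- **The exact step inside u008**: `ψ̄(D)D^{s−1}·Σ_m k̃(m)ψ̄(m)m^{s−1} = Σ_m k̃(m)ψ̄(Dm)(Dm)^{s−1}`
(`= ktildeSeries`), termwise (`ψ̄(D)ψ̄(m) = ψ̄(Dm)`, `D^{s−1}m^{s−1} = (Dm)^{s−1}`); no convergence needed.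
[cite: Zhang2022LandauSiegel, §15 p. 80] -/
theorem ktildeSeries_eq_twist (s : ℂ) :
    conj (x.ψ (D : ZMod x.p)) * (D : ℂ) ^ (s - 1) *
        ∑' m : ℕ, ktilde c' D m * conj (x.ψ (m : ZMod x.p)) / (m : ℂ) ^ (1 - s) =
      ktildeSeries c' x s := by
  rw [ktildeSeries, ← tsum_mul_left]
  refine tsum_congr fun m => ?_
  have hD : ((D * m : ℕ) : ℂ) ^ (1 - s) = (D : ℂ) ^ (1 - s) * (m : ℂ) ^ (1 - s) := by
    rw [Nat.cast_mul, Complex.natCast_mul_natCast_cpow]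
  have hψ : conj (x.ψ ((D * m : ℕ) : ZMod x.p)) =
      conj (x.ψ (D : ZMod x.p)) * conj (x.ψ (m : ZMod x.p)) := by
    rw [Nat.cast_mul, map_mul, map_mul]
  rw [hD, hψ, show s - 1 = -(1 - s) by ring, Complex.cpow_neg, div_eq_mul_inv, div_eq_mul_inv,
    mul_inv]
  ring

end KTildeTwist

/-! ## u009 -/

/-- **§15.u009 from its two halves** (`ε/2 + ε/2`; the typed `Step15_u009` is literally the
composite of the two moves). [cite: Zhang2022LandauSiegel, §15 p. 80] -/
theorem step15_u009_of_parts (c' : ℝ) (ha : Step15_u009a c') (hb : Step15_u009b c') :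
    Step15_u009 c' := by
  intro ε hε
  have hε2 : 0 < ε / 2 := by positivity
  obtain ⟨D₁, h₁⟩ := ha (ε / 2) hε2
  obtain ⟨D₂, h₂⟩ := hb (ε / 2) hε2
  refine ⟨max D₁ D₂, fun D _ χ hD hq hp hA => ?_⟩
  have e₁ := h₁ D χ (le_trans (le_max_left _ _) hD) hq hp hA
  have e₂ := h₂ D χ (le_trans (le_max_right _ _) hD) hq hp hA
  have key : ∀ A B C : ℂ, ‖A - C‖ ≤ ‖A - B‖ + ‖B - C‖ := fun A B C => by
    calc ‖A - C‖ = ‖(A - B) + (B - C)‖ := by rw [sub_add_sub_cancel]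
      _ ≤ ‖A - B‖ + ‖B - C‖ := norm_add_le _ _
  calc _ ≤ _ + _ := key _ (GammaFactor.tau χ * ∑ᶠ x : Chr D, termSegU009 c' χ x) _
    _ ≤ ε / 2 * frakP D + ε / 2 * frakP D := add_le_add e₁ e₂
    _ = ε * frakP D := by ring

/-! ## u011 on the consumer's range -/

/-- **`Step15_u011w` holds** (`C = 1`, every `D`): primitive characters mod a prime `p` are the
non-principal ones; `Σ_{ψ≠1} ψ(n)ψ⁻¹(Dm) = (p − 2)` if `n ≡ Dm`, `= −[p ∤ nDm]` otherwise
(`PrimChar.*`, `Literature…PrimitiveCharOrthogonality`), and `n ≡ Dm (mod p)` with `n, Dm < p` forces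
`n = Dm`. Same proof as `step15_u011_holds`. [cite: Zhang2022LandauSiegel, §15 p. 81] -/
theorem step15_u011w_holds : Step15_u011w := by
  refine ⟨1, 1, fun D _ χ _ _ _ => ?_⟩
  intro p hp n m hn_lt hDm_lt
  haveI : Fact p.Prime := ⟨(Finset.mem_filter.mp hp).2⟩
  rw [sumPrim_eq_sum_erase_one (fun ψ => ψ (n : ZMod p) * conj (ψ ((D * m : ℕ) : ZMod p)))]
  simp_rw [← PrimChar.inv_apply_eq_conj]
  by_cases h : n = D * m
  · rw [if_pos h]
    calc ‖∑ ψ ∈ (Finset.univ : Finset (DirichletCharacter ℂ p)).erase 1,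
            ψ (n : ZMod p) * ψ⁻¹ ((D * m : ℕ) : ZMod p)‖ ≤ (p : ℝ) - 1 :=
          PrimChar.norm_sum_ne_one_le _ _
      _ ≤ 1 * p := by linarith
  · rw [if_neg h]
    exact PrimChar.norm_sum_ne_one_le_one_of_ne fun hh =>
      h ((PrimChar.natCast_eq_natCast_iff_of_lt hn_lt hDm_lt).mp hh)

/-- `Step15_u011w` — `_holds` alias of `step15_u011w_holds` above under the fact's exact name (appended
2026-08-28, D-0026 bookkeeping: the proof term is the existing theorem of this file; no statement,
definition or attribute is edited; no new named fact; the ledger's debt table listed the fact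
unproved). [cite: Zhang2022LandauSiegel, §15 p. 81] -/
theorem _root_.Literature.NumberTheory.LFunctions.Zhang2022.Typed.Section15A.Step15_u011w_holds :
    Step15_u011w :=
  _root_.Literature.NumberTheory.LFunctions.Zhang2022.Typed.Section15A.step15_u011w_holds

end Literature.NumberTheory.LFunctions.Zhang2022.Typed.Section15A
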